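import Literature.Computability.MetaComplexity.TextbookFregeCompleteness
import HarnessLib

/-!
# Implicational completeness is a side condition, not a closed fact

Companion of `Frege.lean` and `TextbookFregeCompleteness.lean`. Cook–Reckhow (1979, §2) define:

* **Def. 2.1.** "A *Frege rule* is a system of formulas `(C₁, …, Cₙ)/D`, where `C₁, …, Cₙ ⊨ D`. …
  An inference system `𝓕` is a finite set of Frege rules."
* **Def. 2.2.** "An inference system `𝓕` is *implicationally complete* if `A₁, …, Aₙ ⊢_𝓕 B`
  whenever `A₁, …, Aₙ ⊨ B`. A *Frege system* is an implicationally complete inference system."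

`Frege.lean` keeps rule lists as plain data (`FregeSystem`) and renders the two side conditions
as predicates, `FregeSystem.IsSound` (Def. 2.1) and
`FregeSystem.IsImplicationallyComplete : FregeSystem → Prop` (Def. 2.2, hypotheses a `Finset`),
with `IsFrege F := F.IsSound ∧ F.IsImplicationallyComplete`. So `IsImplicationallyComplete` is
a *definition* — a hypothesis verified system by system — and not a named fact admitting a
discharge `IsImplicationallyComplete_holds`. This file records exactly that:

* it HOLDS of the concrete system: `TextbookFrege.isImplicationallyComplete_textbookFrege`
  and `isFrege_textbookFrege_holds` (`TextbookFregeCompleteness.lean`, Shoenfield's tautology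
  theorem), whence `exists_isFrege` and, by monotonicity in the rule list
  (`FregeSystem.IsImplicationallyComplete.mono_rules`), every sound inference system containing
  the rules of `textbookFrege` is a Frege system (`isFrege_of_textbookFrege_rules`);
* its universal closure is FALSE: the rule-less inference system derives exactly its hypotheses
  (`FregeSystem.derives_nil_iff`), so it is sound but not implicationally complete
  (`FregeSystem.not_isImplicationallyComplete_nil`, `FregeSystem.not_forall_isImplicationallyComplete`,
  `not_isFrege_nil`);
* the two conditions of Def. 2.1–2.2 are independent: the single axiom scheme `⊢ A` derives every
  formula, hence is implicationally complete but not sound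
  (`FregeSystem.isImplicationallyComplete_anyAxiom`, `FregeSystem.not_isSound_anyAxiom`,
  `not_isFrege_anyAxiom`);
* the elementary consequences of the condition used downstream: completeness for tautologies
  (`FregeSystem.IsImplicationallyComplete.provable`) and derivability from any hypothesis set
  containing a finite entailing subset (`FregeSystem.IsImplicationallyComplete.derives_of_subset`).

The theorems Cook–Reckhow attach to the notion — Thm. 2.3 and Cor. 2.4 (any two Frege systems
over one connective set p-simulate each other; one is polynomially bounded iff all are) — are
`FregeSystem.exists_translation`, `isPolyBounded_iff_of_isFrege_holds` and
`frege_pSimulates_holds` in `Complexity/ProofComplexityProofs.lean`; the soundness analogue of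
this file is the section "`IsSound` is a side condition" of `FregeProofs.lean`.

## References

* S. A. Cook, R. A. Reckhow, *The relative efficiency of propositional proof systems*,
  J. Symbolic Logic 44 (1979) 36–50: §2, Def. 2.1, Def. 2.2, Thm. 2.3, Cor. 2.4.
* J. R. Shoenfield, *Mathematical Logic* (1967), §3.1 (tautology theorem) — via
  `TextbookFregeCompleteness.lean`.
-/

namespace Literature.Computability.MetaComplexity

open _root_.Computability Complexity

namespace FregeSystem

variable {F G : FregeSystem} {Γ : Set (PropForm ℕ)} {π : List (PropForm ℕ)} {φ : PropForm ℕ}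

/-! ### Monotonicity in the rule list -/

/-- An inference by a rule of `F` is an inference by a rule of any system `G` containing the
rules of `F`. [cite: CookReckhow1979, §2 Def. 2.1 (inference by a rule)] -/
theorem IsInferred.mono_rules {prev : List (PropForm ℕ)} {θ : PropForm ℕ}
    (h : F.IsInferred prev θ) (hFG : ∀ r ∈ F.rules, r ∈ G.rules) : G.IsInferred prev θ := by
  obtain ⟨r, hr, σ, hc, hp⟩ := h
  exact ⟨r, hFG r hr, σ, hc, hp⟩

/-- A derivation in `F` is a derivation in any system containing the rules of `F`.
[cite: CookReckhow1979, §2 Def. 2.1 (derivation)] -/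
theorem IsDerivation.mono_rules (h : F.IsDerivation Γ π) (hFG : ∀ r ∈ F.rules, r ∈ G.rules) :
    G.IsDerivation Γ π :=
  fun k hk => (h k hk).imp_right fun hinf => hinf.mono_rules hFG

/-- Derivability `Γ ⊢_F φ` persists in any system containing the rules of `F`.
[cite: CookReckhow1979, §2 Def. 2.1 (derivation)] -/
theorem Derives.mono_rules (h : F.Derives Γ φ) (hFG : ∀ r ∈ F.rules, r ∈ G.rules) :
    G.Derives Γ φ := by
  obtain ⟨π, hπ, hlast⟩ := h
  exact ⟨π, hπ.mono_rules hFG, hlast⟩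

/-- **Implicational completeness is inherited by systems with more rules.**
[cite: CookReckhow1979, §2 Def. 2.2] -/
theorem IsImplicationallyComplete.mono_rules (h : F.IsImplicationallyComplete)
    (hFG : ∀ r ∈ F.rules, r ∈ G.rules) : G.IsImplicationallyComplete :=
  fun Γ φ hφ => (h Γ φ hφ).mono_rules hFG

/-! ### Elementary consequences of the condition -/

/-- An implicationally complete system proves every tautology (the case of no hypotheses of
Def. 2.2). [cite: CookReckhow1979, §2 Def. 2.2] -/
theorem IsImplicationallyComplete.provable (h : F.IsImplicationallyComplete)
    (hφ : φ.IsTautology) : F.Provable φ := by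
  obtain ⟨π, hπ, hlast⟩ := h ∅ φ fun σ _ => hφ σ
  exact ⟨π, hπ.mono (by simp), hlast⟩

/-- Def. 2.2 with an arbitrary hypothesis set: if some finite `Δ ⊆ Γ` entails `φ`, an
implicationally complete system derives `φ` from `Γ` (derivations are monotone in the
hypotheses). [cite: CookReckhow1979, §2 Def. 2.2] -/
theorem IsImplicationallyComplete.derives_of_subset (h : F.IsImplicationallyComplete)
    {Δ : Finset (PropForm ℕ)} (hΔ : ↑Δ ⊆ Γ)
    (hφ : ∀ σ : ℕ → Bool, (∀ ψ ∈ Δ, ψ.eval σ = true) → φ.eval σ = true) : F.Derives Γ φ := by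
  obtain ⟨π, hπ, hlast⟩ := h Δ φ hφ
  exact ⟨π, hπ.mono hΔ, hlast⟩

/-! ### The universal closure fails: the rule-less inference system -/

/-- The inference system with no rules derives exactly its hypotheses.
[cite: CookReckhow1979, §2 Def. 2.1 (derivation)] -/
theorem derives_nil_iff : (⟨[]⟩ : FregeSystem).Derives Γ φ ↔ φ ∈ Γ := by
  refine ⟨fun ⟨π, hπ, hlast⟩ => ?_, fun h => ⟨[φ], fun k hk => Or.inl ?_, rfl⟩⟩
  · obtain ⟨k, hk, rfl⟩ := List.getElem_of_mem (List.mem_of_getLast? hlast)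
    rcases hπ k hk with hm | ⟨r, hr, -⟩
    · exact hm
    · simp at hr
  · have hk0 : k = 0 := by simpa using hk
    subst hk0
    simpa using h

/-- **The rule-less inference system is not implicationally complete**: `⊨ ⊤`, but `⊤` is not
derivable from no hypotheses. So `IsImplicationallyComplete` is a genuine side condition on
the data `FregeSystem` (Cook–Reckhow build it into the notion of Frege system, Def. 2.2).
[cite: CookReckhow1979, §2 Def. 2.2] -/
theorem not_isImplicationallyComplete_nil : ¬ (⟨[]⟩ : FregeSystem).IsImplicationallyComplete := by
  intro h
  have hd := h ∅ (.const true) fun σ _ => by simp [PropForm.eval]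
  rw [Finset.coe_empty, derives_nil_iff] at hd
  exact hd

/-- Hence `IsImplicationallyComplete` does not hold of every rule list: the predicate
`FregeSystem.IsImplicationallyComplete : FregeSystem → Prop` (Def. 2.2) has no closed discharge
`∀ F, F.IsImplicationallyComplete`; it is verified per system
(`TextbookFrege.isImplicationallyComplete_textbookFrege`). [cite: CookReckhow1979, §2 Def. 2.2] -/
theorem not_forall_isImplicationallyComplete : ¬ ∀ F : FregeSystem, F.IsImplicationallyComplete :=
  fun h => not_isImplicationallyComplete_nil (h _)

/-! ### Independence of the two conditions of Def. 2.1–2.2 -/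

/-- The single axiom scheme `⊢ A` (`A` a metavariable) derives every formula in one line, so
this inference system is implicationally complete. [cite: CookReckhow1979, §2 Def. 2.2] -/
theorem isImplicationallyComplete_anyAxiom :
    (⟨[⟨[], .var 0⟩]⟩ : FregeSystem).IsImplicationallyComplete := by
  intro Γ φ _
  refine ⟨[φ], fun k hk => Or.inr ?_, rfl⟩
  have hk0 : k = 0 := by simpa using hk
  subst hk0
  exact ⟨⟨[], .var 0⟩, List.mem_singleton_self _, fun _ => φ, by simp [PropForm.subst], by simp⟩

/-- … but it is not sound (`A := ⊥`): implicational completeness does not entail the condition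
`C₁, …, Cₙ ⊨ D` of Def. 2.1. [cite: CookReckhow1979, §2 Def. 2.1] -/
theorem not_isSound_anyAxiom : ¬ (⟨[⟨[], .var 0⟩]⟩ : FregeSystem).IsSound := fun h => by
  simpa [PropForm.eval] using h _ (List.mem_singleton_self _) (fun _ => false) (by simp)

end FregeSystem

/-- The rule-less inference system is (vacuously) sound but not a Frege system: soundness does
not entail implicational completeness. [cite: CookReckhow1979, §2 Def. 2.2] -/
theorem not_isFrege_nil : ¬ IsFrege (⟨[]⟩ : FregeSystem) :=
  fun h => FregeSystem.not_isImplicationallyComplete_nil h.2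

/-- The axiom scheme `⊢ A` is implicationally complete but not a Frege system.
[cite: CookReckhow1979, §2 Def. 2.2] -/
theorem not_isFrege_anyAxiom : ¬ IsFrege (⟨[⟨[], .var 0⟩]⟩ : FregeSystem) :=
  fun h => FregeSystem.not_isSound_anyAxiom h.1

/-! ### The condition holds of the textbook system and of its sound extensions -/

/-- A sound inference system containing the rules of an implicationally complete one is a Frege
system. [cite: CookReckhow1979, §2 Def. 2.2] -/
theorem IsFrege.of_rules_subset {F G : FregeSystem} (hG : G.IsSound)
    (hF : F.IsImplicationallyComplete) (hFG : ∀ r ∈ F.rules, r ∈ G.rules) : IsFrege G :=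
  ⟨hG, hF.mono_rules hFG⟩

/-- **Every sound inference system containing the nine rule schemes of `textbookFrege` is a
Frege system** (implicational completeness of `textbookFrege`, Shoenfield's tautology theorem,
is inherited). [cite: CookReckhow1979, §2 Def. 2.2] -/
theorem isFrege_of_textbookFrege_rules {G : FregeSystem} (hG : G.IsSound)
    (h : ∀ r ∈ textbookFrege.rules, r ∈ G.rules) : IsFrege G :=
  IsFrege.of_rules_subset hG TextbookFrege.isImplicationallyComplete_textbookFrege h

/-- Frege systems over the basis of `PropForm` exist: `textbookFrege` is one
(`isFrege_textbookFrege_holds`). Cook–Reckhow's own example after Def. 2.2 is Frege's system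
made schematic (modus ponens and six axiom schemes over `¬, ⊃`).
[cite: CookReckhow1979, §2 Def. 2.2 (and the example following it)] -/
theorem exists_isFrege : ∃ F : FregeSystem, IsFrege F :=
  ⟨textbookFrege, isFrege_textbookFrege_holds⟩

end Literature.Computability.MetaComplexity
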